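import Mathlib
import Summits.Ventures.PercRepro2.CoinChainXAMMinusInterp

/-!
# (M⁻) for every entry structure — the slack certificates
(blind cell PercRepro2, night-2 g31; proofs/NIGHT2-DARC.md §73.6h)

With the McM slacks `s_x = L·XM − t·Px`, `s_y`, the lsm slack `Λ = XYM·t − XM·YM`, the `JM`-slacks `σ_J = δ·XM − t·XJ`,
`σ'_J`, the `(B, B)`-slacks `σ_B = u·XM − t·XU`, `σ'_B` (at `a = 0`) or `σ̂_B = (a + u)·XM − t·XU` (general), the (M⁻) polynomial
`E'` of `mgate_of_mminus` satisfies the EXACT identities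
* `t²·E'(0, δ) = L·s_x·s_y·XM·YM + L³Λ² + L²Λ(XM·σ'_B + YM·σ_B) + ΛL(σ_J·s_y + σ'_J·s_x) + Λtδ(Py·s_x + Px·s_y)`  (`cg_mminus_zero_id`),
* `t²·E'(a, δ) = L·s_x·s_y·XM·YM + L³Λ² + L²Λ(XM·σ̂'_B + YM·σ̂_B) + ΛL(σ_J·s_y + σ'_J·s_x) + Λtδ(Py·s_x + Px·s_y) + t²·L·XYM·a·Px·Py`  (`cg_mminus_gen_id`),
* `E'(a, J − a) = E'(0, J) + a·Px·Py·(2Λ + L·XYM)`  (`cg_mminus_slope`: the slope in the ideal mass at fixed `J = a + δ` is nonnegative),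
(all by `ring`; re-verified in rationals, mining/night-2/g31/py/).  Hence (M⁻) holds — for ANY entry structure (the unmarked killed
mass `K₀` is free) — (i) at `a = 0` (`cg_mminus_zero`: the facts `McM`, `MM`, `JM` and `(B, B)` at `a = 0`), (ii) for every `a`
whenever the `(B, B)` facts hold without the ideal, `u·XM ≥ t·XU`, `u·YM ≥ t·YU` (`cg_mminus_of_BB0`: by the slope), and (iii) for
every `a` whenever the `JM` facts hold without the ideal, `δ·XM ≥ t·XJ`, `δ·YM ≥ t·YJ` (`cg_mminus_of_JM0`: every term of
`cg_mminus_gen_id` is then nonnegative).  What is left of (M⁻) is the «doubly rich» regime: both the coin-killed and the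
coin-surviving laws marker-richer than the sure-entered clusters, which only the ideal's mass allows.
-/

namespace Summit.Ventures.PercRepro2.Coin

section MMinusGen

variable {R : Type*} [Field R] [LinearOrder R] [IsStrictOrderedRing R]

omit [LinearOrder R] [IsStrictOrderedRing R] in
/-- **The `a = 0` identity**: `t²·E'(0, δ)` is the five-term sum of products of slacks. -/
theorem cg_mminus_zero_id (δ u t XJ XU XM YJ YU YM XYM : R) :
    t * t * (XYM * ((0 * (0 + δ + u + t) * (XJ + XU + XM) * (YJ + YU + YM) - (XJ * (0 + δ + u + t) - δ * (XJ + XU + XM)) * (YM * (0 + δ + u + t) - t * (YJ + YU + YM)) - (YJ * (0 + δ + u + t) - δ * (YJ + YU + YM)) * (XM * (0 + δ + u + t) - t * (XJ + XU + XM))) + ((0 + δ + u + t) * ((0 + δ + u + t) - (XJ + XU + XM)) * ((0 + δ + u + t) - (YJ + YU + YM)) + (XJ * (0 + δ + u + t) - δ * (XJ + XU + XM)) * ((0 + δ + u + t) - (YJ + YU + YM)) + (YJ * (0 + δ + u + t) - δ * (YJ + YU + YM)) * ((0 + δ + u + t) - (XJ + XU + XM))) * XYM + (-(((0 + δ + u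 + t) * (0 + δ + u + t) * (YJ + YU + YM) + (0 + δ + u + t) * ((0 + δ + u + t) * (YU + YM) - (YJ + YU + YM) * (0 + u + t))) - ((0 + δ + u + t) * (XJ + XU + XM) * (YJ + YU + YM) + ((0 + δ + u + t) * (XU + XM) - (XJ + XU + XM) * (0 + u + t)) * (YJ + YU + YM) + ((0 + δ + u + t) * (YU + YM) - (YJ + YU + YM) * (0 + u + t)) * (XJ + XU + XM)))) * (XM - XYM) + (-(((0 + δ + u + t) * (0 + δ + u + t) * (XJ + XU + XM) + (0 + δ + u + t) * ((0 + δ + u + t) * (XU + XM) - (XJ + XU + XM) * (0 + u + t))) - ((0 + δ + u + t) * (XJ + XU + XM) * (YJ + YU + YM) + ((0 + δ + u + t) * (XU + XM) - (XJ + XU + XM) * (0 + u + t)) * (YJ + YU + YM) + ((0 + δ + u + t) * (YU + YM) - (YJ + YU + YM) * (0 + u + t)) * (XJ + XU + XM)))) * (YM - XYM)) + ((0 + δ + u + t) * (XJ + XU + XM) * (YJ + YU + YM) + ((0 + δ + u + t) * (XU + XM) - (XJ + XU + XM) * (0 + u + t)) * (YJ + YU + YM) + ((0 + δ + u + t) *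 (YU + YM) - (YJ + YU + YM) * (0 + u + t)) * (XJ + XU + XM)) * ((XM - XYM) * (YM - XYM))) = (δ + u + t) * ((δ + u + t) * XM - t * (XJ + XU + XM)) * ((δ + u + t) * YM - t * (YJ + YU + YM)) * XM * YM + (δ + u + t) * (δ + u + t) * (δ + u + t) * (XYM * t - XM * YM) * (XYM * t - XM * YM) + (δ + u + t) * (δ + u + t) * (XYM * t - XM * YM) * (XM * (u * YM - t * YU) + YM * (u * XM - t * XU)) + (XYM * t - XM * YM) * (δ + u + t) * ((δ * XM - t * XJ) * ((δ + u + t) * YM - t * (YJ + YU + YM)) + (δ * YM - t * YJ) * ((δ + u + t) * XM - t * (XJ + XU + XM))) + (XYM * t - XM * YM) * t * δ * ((YJ + YU + YM) * ((δ + u + t) * XM - t * (XJ + XU + XM)) + (XJ + XU + XM) * ((δ + u + t) * YM - t * (YJ + YU + YM))) := by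
  ring

omit [LinearOrder R] [IsStrictOrderedRing R] in
/-- **The general identity**: `t²·E'(a, δ)` with the hatted `(B, B)`-slacks and the plain `JM`-slacks. -/
theorem cg_mminus_gen_id (a δ u t XJ XU XM YJ YU YM XYM : R) :
    t * t * (XYM * ((a * (a + δ + u + t) * (XJ + XU + XM) * (YJ + YU + YM) - (XJ * (a + δ + u + t) - δ * (XJ + XU + XM)) * (YM * (a + δ + u + t) - t * (YJ + YU + YM)) - (YJ * (a + δ + u + t) - δ * (YJ + YU + YM)) * (XM * (a + δ + u + t) - t * (XJ + XU + XM))) + ((a + δ + u + t) * ((a + δ + u + t) - (XJ + XU + XM)) * ((a + δ + u + t) - (YJ + YU + YM)) + (XJ * (a + δ + u + t) - δ * (XJ + XU + XM)) * ((a + δ + u + t) - (YJ + YU + YM)) + (YJ * (a + δ + u + t) - δ * (YJ + YU + YM)) * ((a + δ + u + t) - (XJ + XU + XM))) * XYM + (-(((a + δ + u + t) * (a + δ + u + t) * (YJ + YU + YM) + (a + δ + u + t) * ((a + δ + u + t) * (YU + YM) - (YJ + YU + YM) * (a + u + t))) - ((a + δ + u + t) * (XJ + XU + XM) * (YJ +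 YU + YM) + ((a + δ + u + t) * (XU + XM) - (XJ + XU + XM) * (a + u + t)) * (YJ + YU + YM) + ((a + δ + u + t) * (YU + YM) - (YJ + YU + YM) * (a + u + t)) * (XJ + XU + XM)))) * (XM - XYM) + (-(((a + δ + u + t) * (a + δ + u + t) * (XJ + XU + XM) + (a + δ + u + t) * ((a + δ + u + t) * (XU + XM) - (XJ + XU + XM) * (a + u + t))) - ((a + δ + u + t) * (XJ + XU + XM) * (YJ + YU + YM) + ((a + δ + u + t) * (XU + XM) - (XJ + XU + XM) * (a + u + t)) * (YJ + YU + YM) + ((a + δ + u + t) * (YU + YM) - (YJ + YU + YM) * (a + u + t)) * (XJ + XU + XM)))) * (YM - XYM)) + ((a + δ + u + t) * (XJ + XU + XM) * (YJ + YU + YM) + ((a + δ + u + t) * (XU + XM) - (XJ + XU + XM) * (a + u + t)) * (YJ + YU + YM) + ((a + δ + u + t) * (YU + YM) - (YJ + YU + YM) * (a + u + t)) * (XJ + XU + XM)) * ((XM - XYM) * (YM - XYM))) = (a + δ + u + t) * ((a + δ + u + t) * XM - t * (XJ + XU + XM)) * ((a + δ + u + t) * YM - t * (YJ + YU + YM))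 * XM * YM + (a + δ + u + t) * (a + δ + u + t) * (a + δ + u + t) * (XYM * t - XM * YM) * (XYM * t - XM * YM) + (a + δ + u + t) * (a + δ + u + t) * (XYM * t - XM * YM) * (XM * ((a + u) * YM - t * YU) + YM * ((a + u) * XM - t * XU)) + (XYM * t - XM * YM) * (a + δ + u + t) * ((δ * XM - t * XJ) * ((a + δ + u + t) * YM - t * (YJ + YU + YM)) + (δ * YM - t * YJ) * ((a + δ + u + t) * XM - t * (XJ + XU + XM))) + (XYM * t - XM * YM) * t * δ * ((YJ + YU + YM) * ((a + δ + u + t) * XM - t * (XJ + XU + XM)) + (XJ + XU + XM) * ((a + δ + u + t) * YM - t * (YJ + YU + YM))) + t * t * (a + δ + u + t) * XYM * a * (XJ + XU + XM) * (YJ + YU + YM) := by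
  ring

omit [LinearOrder R] [IsStrictOrderedRing R] in
/-- **The slope identity**: along `a + δ = J` the (M⁻) polynomial is affine in `a` with slope `Px·Py·(2Λ + L·XYM)`. -/
theorem cg_mminus_slope (a J u t XJ XU XM YJ YU YM XYM : R) :
    XYM * ((a * (a + (J - a) + u + t) * (XJ + XU + XM) * (YJ + YU + YM) - (XJ * (a + (J - a) + u + t) - (J - a) * (XJ + XU + XM)) * (YM * (a + (J - a) + u + t) - t * (YJ + YU + YM)) - (YJ * (a + (J - a) + u + t) - (J - a) * (YJ + YU + YM)) * (XM * (a + (J - a) + u + t) - t * (XJ + XU + XM))) + ((a + (J - a) + u + t) * ((a + (J - a) + u + t) - (XJ + XU + XM)) * ((a + (J - a) + u + t) - (YJ + YU + YM)) + (XJ * (a + (J - a) + u + t) - (J - a) * (XJ + XU + XM)) * ((a + (J - a) + u + t) - (YJ + YU + YM)) + (YJ * (a + (J - a) + u + t) - (J - a) * (YJ + YU + YM)) * ((a + (J - a) + u + t) - (XJ + XU + XM))) * XYM + (-(((a + (J - a) + u + t) * (a + (J - a) + u + t) * (YJ + YU + YM) + (a + (J - a) + u + t) * ((a + (J - a) + u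 + t) * (YU + YM) - (YJ + YU + YM) * (a + u + t))) - ((a + (J - a) + u + t) * (XJ + XU + XM) * (YJ + YU + YM) + ((a + (J - a) + u + t) * (XU + XM) - (XJ + XU + XM) * (a + u + t)) * (YJ + YU + YM) + ((a + (J - a) + u + t) * (YU + YM) - (YJ + YU + YM) * (a + u + t)) * (XJ + XU + XM)))) * (XM - XYM) + (-(((a + (J - a) + u + t) * (a + (J - a) + u + t) * (XJ + XU + XM) + (a + (J - a) + u + t) * ((a + (J - a) + u + t) * (XU + XM) - (XJ + XU + XM) * (a + u + t))) - ((a + (J - a) + u + t) * (XJ + XU + XM) * (YJ + YU + YM) + ((a + (J - a) + u + t) * (XU + XM) - (XJ + XU + XM) * (a + u + t)) * (YJ + YU + YM) + ((a + (J - a) + u + t) * (YU + YM) - (YJ + YU + YM) * (a + u + t)) * (XJ + XU + XM)))) * (YM - XYM)) + ((a + (J - a) + u + t) * (XJ + XU + XM) * (YJ + YU + YM) + ((a + (J - a) + u + t) * (XU + XM) - (XJ + XU + XM) * (a + u + t)) * (YJ + YU + YM) + ((a + (J - a) + u + t) * (YU + YM) - (YJ + YU + YM) * (a + u + t)) * (XJ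 + XU + XM)) * ((XM - XYM) * (YM - XYM)) = (XYM * ((0 * (0 + J + u + t) * (XJ + XU + XM) * (YJ + YU + YM) - (XJ * (0 + J + u + t) - J * (XJ + XU + XM)) * (YM * (0 + J + u + t) - t * (YJ + YU + YM)) - (YJ * (0 + J + u + t) - J * (YJ + YU + YM)) * (XM * (0 + J + u + t) - t * (XJ + XU + XM))) + ((0 + J + u + t) * ((0 + J + u + t) - (XJ + XU + XM)) * ((0 + J + u + t) - (YJ + YU + YM)) + (XJ * (0 + J + u + t) - J * (XJ + XU + XM)) * ((0 + J + u + t) - (YJ + YU + YM)) + (YJ * (0 + J + u + t) - J * (YJ + YU + YM)) * ((0 + J + u + t) - (XJ + XU + XM))) * XYM + (-(((0 + J + u + t) * (0 + J + u + t) * (YJ + YU + YM) + (0 + J + u + t) * ((0 + J + u + t) * (YU + YM) - (YJ + YU + YM) * (0 + u + t))) - ((0 + J + u + t) * (XJ + XU + XM) * (YJ + YU + YM) + ((0 + J + u + t) * (XU + XM) - (XJ + XU + XM) * (0 + u + t)) * (YJ + YU + YM) + ((0 + J + u + t) * (YU + YM) - (YJ + YU + YM) * (0 + u + t)) * (XJ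 + XU + XM)))) * (XM - XYM) + (-(((0 + J + u + t) * (0 + J + u + t) * (XJ + XU + XM) + (0 + J + u + t) * ((0 + J + u + t) * (XU + XM) - (XJ + XU + XM) * (0 + u + t))) - ((0 + J + u + t) * (XJ + XU + XM) * (YJ + YU + YM) + ((0 + J + u + t) * (XU + XM) - (XJ + XU + XM) * (0 + u + t)) * (YJ + YU + YM) + ((0 + J + u + t) * (YU + YM) - (YJ + YU + YM) * (0 + u + t)) * (XJ + XU + XM)))) * (YM - XYM)) + ((0 + J + u + t) * (XJ + XU + XM) * (YJ + YU + YM) + ((0 + J + u + t) * (XU + XM) - (XJ + XU + XM) * (0 + u + t)) * (YJ + YU + YM) + ((0 + J + u + t) * (YU + YM) - (YJ + YU + YM) * (0 + u + t)) * (XJ + XU + XM)) * ((XM - XYM) * (YM - XYM))) + a * ((XJ + XU + XM) * (YJ + YU + YM) * (2 * (XYM * t - XM * YM) + (J + u + t) * XYM)) := by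
  ring

set_option maxHeartbeats 4000000 in
/-- **(M⁻) at `a = 0`, any entry structure**: the facts `McM` (`s_x, s_y ≥ 0`), `MM` (`Λ ≥ 0`), `JM` and `(B, B)` at `a = 0`. -/
theorem cg_mminus_zero (δ u t XJ XU XM YJ YU YM XYM : R)
    (hδ : 0 ≤ δ) (hu : 0 ≤ u) (ht : 0 ≤ t) (hXJ : 0 ≤ XJ) (hXU : 0 ≤ XU) (hXM : 0 ≤ XM)
    (hYJ : 0 ≤ YJ) (hYU : 0 ≤ YU) (hYM : 0 ≤ YM)
    (hsx : 0 ≤ (δ + u + t) * XM - t * (XJ + XU + XM)) (hsy : 0 ≤ (δ + u + t) * YM - t * (YJ + YU + YM))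
    (hMM : 0 ≤ XYM * t - XM * YM)
    (hJMx : 0 ≤ δ * XM - t * XJ) (hJMy : 0 ≤ δ * YM - t * YJ)
    (hBBx : 0 ≤ u * XM - t * XU) (hBBy : 0 ≤ u * YM - t * YU)
    (hXYM : 0 ≤ XYM) (hXMt : XM ≤ t) (hYMt : YM ≤ t) (hXYMx : XYM ≤ XM) :
    0 ≤ XYM * ((0 * (0 + δ + u + t) * (XJ + XU + XM) * (YJ + YU + YM) - (XJ * (0 + δ + u + t) - δ * (XJ + XU + XM)) * (YM * (0 + δ + u + t) - t * (YJ + YU + YM)) - (YJ * (0 + δ + u + t) - δ * (YJ + YU + YM)) * (XM * (0 + δ + u + t) - t * (XJ + XU + XM))) + ((0 + δ + u + t) * ((0 + δ + u + t) - (XJ + XU + XM)) * ((0 + δ + u + t) - (YJ + YU + YM)) + (XJ * (0 + δ + u + t) - δ * (XJ + XU + XM)) * ((0 + δ + u + t) - (YJ + YU + YM)) + (YJ * (0 + δ + u + t) - δ * (YJ + YU + YM)) * ((0 + δ + u + t) - (XJ + XU + XM))) * XYM + (-(((0 + δ + u + t) * (0 + δ + u + t) * (YJ + YU + YM) + (0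 + δ + u + t) * ((0 + δ + u + t) * (YU + YM) - (YJ + YU + YM) * (0 + u + t))) - ((0 + δ + u + t) * (XJ + XU + XM) * (YJ + YU + YM) + ((0 + δ + u + t) * (XU + XM) - (XJ + XU + XM) * (0 + u + t)) * (YJ + YU + YM) + ((0 + δ + u + t) * (YU + YM) - (YJ + YU + YM) * (0 + u + t)) * (XJ + XU + XM)))) * (XM - XYM) + (-(((0 + δ + u + t) * (0 + δ + u + t) * (XJ + XU + XM) + (0 + δ + u + t) * ((0 + δ + u + t) * (XU + XM) - (XJ + XU + XM) * (0 + u + t))) - ((0 + δ + u + t) * (XJ + XU + XM) * (YJ + YU + YM) + ((0 + δ + u + t) * (XU + XM) - (XJ + XU + XM) * (0 + u + t)) * (YJ + YU + YM) + ((0 + δ + u + t) * (YU + YM) - (YJ + YU + YM) * (0 + u + t)) * (XJ + XU + XM)))) * (YM - XYM)) + ((0 + δ + u + t) * (XJ + XU + XM) * (YJ + YU + YM) + ((0 + δ + u + t) * (XU + XM) - (XJ + XU + XM) * (0 + u + t)) * (YJ + YU + YM) + ((0 + δ + u + t) * (YU + YM) - (YJ + YU + YM) * (0 + u + t)) * (XJ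 + XU + XM)) * ((XM - XYM) * (YM - XYM)) := by
  have hL : 0 ≤ δ + u + t := by linarith
  have hPx : 0 ≤ XJ + XU + XM := by linarith
  have hPy : 0 ≤ YJ + YU + YM := by linarith
  rcases ht.lt_or_eq with htpos | ht0
  · have H1 := mul_nonneg (mul_nonneg (mul_nonneg (mul_nonneg hL hsx) hsy) hXM) hYM
    have H2 := mul_nonneg (mul_nonneg (mul_nonneg (mul_nonneg hL hL) hL) hMM) hMM
    have H3 := mul_nonneg (mul_nonneg (mul_nonneg hL hL) hMM) (add_nonneg (mul_nonneg hXM hBBy) (mul_nonneg hYM hBBx))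
    have H4 := mul_nonneg (mul_nonneg hMM hL) (add_nonneg (mul_nonneg hJMx hsy) (mul_nonneg hJMy hsx))
    have H5 := mul_nonneg (mul_nonneg (mul_nonneg hMM ht) hδ) (add_nonneg (mul_nonneg hPy hsx) (mul_nonneg hPx hsy))
    have key : 0 ≤ t * t * (XYM * ((0 * (0 + δ + u + t) * (XJ + XU + XM) * (YJ + YU + YM) - (XJ * (0 + δ + u + t) - δ * (XJ + XU + XM)) * (YM * (0 + δ + u + t) - t * (YJ + YU + YM)) - (YJ * (0 + δ + u + t) - δ * (YJ + YU + YM)) * (XM * (0 + δ + u + t) - t * (XJ + XU + XM))) + ((0 + δ + u + t) * ((0 + δ + u + t) - (XJ + XU + XM)) * ((0 + δ + u + t) - (YJ + YU + YM)) + (XJ * (0 + δ + u + t) - δ * (XJ + XU + XM)) * ((0 + δ + u + t) - (YJ + YU + YM)) + (YJ * (0 + δ + u + t) - δ * (YJ + YU + YM)) * ((0 + δ + u + t) - (XJ + XU + XM))) * XYM + (-(((0 + δ + u + t) * (0 + δ + u + t) * (YJ + YU + YM) + (0 + δ + u + t) * ((0 + δ + u + t) * (YU + YM) - (YJ + YU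 + YM) * (0 + u + t))) - ((0 + δ + u + t) * (XJ + XU + XM) * (YJ + YU + YM) + ((0 + δ + u + t) * (XU + XM) - (XJ + XU + XM) * (0 + u + t)) * (YJ + YU + YM) + ((0 + δ + u + t) * (YU + YM) - (YJ + YU + YM) * (0 + u + t)) * (XJ + XU + XM)))) * (XM - XYM) + (-(((0 + δ + u + t) * (0 + δ + u + t) * (XJ + XU + XM) + (0 + δ + u + t) * ((0 + δ + u + t) * (XU + XM) - (XJ + XU + XM) * (0 + u + t))) - ((0 + δ + u + t) * (XJ + XU + XM) * (YJ + YU + YM) + ((0 + δ + u + t) * (XU + XM) - (XJ + XU + XM) * (0 + u + t)) * (YJ + YU + YM) + ((0 + δ + u + t) * (YU + YM) - (YJ + YU + YM) * (0 + u + t)) * (XJ + XU + XM)))) * (YM - XYM)) + ((0 + δ + u + t) * (XJ + XU + XM) * (YJ + YU + YM) + ((0 + δ + u + t) * (XU + XM) - (XJ + XU + XM) * (0 + u + t)) * (YJ + YU + YM) + ((0 + δ + u + t) * (YU + YM) - (YJ + YU + YM) * (0 + u + t)) * (XJ + XU + XM)) * ((XM - XYM) * (YM - XYM))) := by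
      rw [cg_mminus_zero_id]
      linear_combination H1 + H2 + H3 + H4 + H5
    exact (mul_nonneg_iff_of_pos_left (mul_pos htpos htpos)).mp key
  · have hXM0 : XM = 0 := le_antisymm (by linarith) hXM
    have hYM0 : YM = 0 := le_antisymm (by linarith) hYM
    have hXYM0 : XYM = 0 := le_antisymm (by linarith) hXYM
    rw [← ht0, hXM0, hYM0, hXYM0]
    simp

set_option maxHeartbeats 4000000 in
/-- **(M⁻) for every ideal mass when the `(B, B)` facts hold without the ideal** (`u·XM ≥ t·XU`, `u·YM ≥ t·YU`):
by the slope identity and the `a = 0` theorem at the point `(0, a + δ)`. -/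
theorem cg_mminus_of_BB0 (a δ u t XJ XU XM YJ YU YM XYM : R)
    (ha : 0 ≤ a) (hδ : 0 ≤ δ) (hu : 0 ≤ u) (ht : 0 ≤ t) (hXJ : 0 ≤ XJ) (hXU : 0 ≤ XU) (hXM : 0 ≤ XM)
    (hYJ : 0 ≤ YJ) (hYU : 0 ≤ YU) (hYM : 0 ≤ YM) (hXYM : 0 ≤ XYM)
    (hsx : 0 ≤ (a + δ + u + t) * XM - t * (XJ + XU + XM)) (hsy : 0 ≤ (a + δ + u + t) * YM - t * (YJ + YU + YM))
    (hMM : 0 ≤ XYM * t - XM * YM)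
    (hJMx : 0 ≤ (a + δ) * XM - t * XJ) (hJMy : 0 ≤ (a + δ) * YM - t * YJ)
    (hBBx : 0 ≤ u * XM - t * XU) (hBBy : 0 ≤ u * YM - t * YU)
    (hXMt : XM ≤ t) (hYMt : YM ≤ t) (hXYMx : XYM ≤ XM) :
    0 ≤ XYM * ((a * (a + δ + u + t) * (XJ + XU + XM) * (YJ + YU + YM) - (XJ * (a + δ + u + t) - δ * (XJ + XU + XM)) * (YM * (a + δ + u + t) - t * (YJ + YU + YM)) - (YJ * (a + δ + u + t) - δ * (YJ + YU + YM)) * (XM * (a + δ + u + t) - t * (XJ + XU + XM))) + ((a + δ + u + t) * ((a + δ + u + t) - (XJ + XU + XM)) * ((a + δ + u + t) - (YJ + YU + YM)) + (XJ * (a + δ + u + t) - δ * (XJ + XU + XM)) * ((a + δ + u + t) - (YJ + YU + YM)) + (YJ * (a + δ + u + t) - δ * (YJ + YU + YM)) * ((a + δ + u + t) - (XJ + XU + XM))) * XYM + (-(((a + δ + u + t) * (a + δ + u + t) * (YJ + YU + YM) + (a + δ + u + t) * ((a + δ + u + t) * (YU + YM) - (YJ + YU + YM) * (a + u + t))) -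 ((a + δ + u + t) * (XJ + XU + XM) * (YJ + YU + YM) + ((a + δ + u + t) * (XU + XM) - (XJ + XU + XM) * (a + u + t)) * (YJ + YU + YM) + ((a + δ + u + t) * (YU + YM) - (YJ + YU + YM) * (a + u + t)) * (XJ + XU + XM)))) * (XM - XYM) + (-(((a + δ + u + t) * (a + δ + u + t) * (XJ + XU + XM) + (a + δ + u + t) * ((a + δ + u + t) * (XU + XM) - (XJ + XU + XM) * (a + u + t))) - ((a + δ + u + t) * (XJ + XU + XM) * (YJ + YU + YM) + ((a + δ + u + t) * (XU + XM) - (XJ + XU + XM) * (a + u + t)) * (YJ + YU + YM) + ((a + δ + u + t) * (YU + YM) - (YJ + YU + YM) * (a + u + t)) * (XJ + XU + XM)))) * (YM - XYM)) + ((a + δ + u + t) * (XJ + XU + XM) * (YJ + YU + YM) + ((a + δ + u + t) * (XU + XM) - (XJ + XU + XM) * (a + u + t)) * (YJ + YU + YM) + ((a + δ + u + t) * (YU + YM) - (YJ + YU + YM) * (a + u + t)) * (XJ + XU + XM)) * ((XM - XYM) * (YM - XYM)) := by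
  have h0 := cg_mminus_zero (a + δ) u t XJ XU XM YJ YU YM XYM (by linarith) hu ht hXJ hXU hXM hYJ hYU hYM
    (by linear_combination hsx) (by linear_combination hsy) hMM hJMx hJMy hBBx hBBy hXYM hXMt hYMt hXYMx
  have hs := cg_mminus_slope a (a + δ) u t XJ XU XM YJ YU YM XYM
  have hslope : 0 ≤ a * ((XJ + XU + XM) * (YJ + YU + YM) * (2 * (XYM * t - XM * YM) + ((a + δ) + u + t) * XYM)) :=
    mul_nonneg ha (mul_nonneg (mul_nonneg (by linarith) (by linarith)) (by nlinarith [hMM, hXYM]))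
  have e : (XYM * ((a * (a + δ + u + t) * (XJ + XU + XM) * (YJ + YU + YM) - (XJ * (a + δ + u + t) - δ * (XJ + XU + XM)) * (YM * (a + δ + u + t) - t * (YJ + YU + YM)) - (YJ * (a + δ + u + t) - δ * (YJ + YU + YM)) * (XM * (a + δ + u + t) - t * (XJ + XU + XM))) + ((a + δ + u + t) * ((a + δ + u + t) - (XJ + XU + XM)) * ((a + δ + u + t) - (YJ + YU + YM)) + (XJ * (a + δ + u + t) - δ * (XJ + XU + XM)) * ((a + δ + u + t) - (YJ + YU + YM)) + (YJ * (a + δ + u + t) - δ * (YJ + YU + YM)) * ((a + δ + u + t) - (XJ + XU + XM))) * XYM + (-(((a + δ + u + t) * (a + δ + u + t) * (YJ + YU + YM) + (a + δ + u + t) * ((a + δ + u + t) * (YU + YM) - (YJ + YU + YM) * (a + u + t))) - ((a + δ + u + t) * (XJ + XU + XM) * (YJ + YU + YM) + ((a + δ + u + t) * (XU + XM) - (XJ + XU + XM) * (a + u + t)) * (YJ + YU + YM) + ((a + δ + u + t) * (YU + YM) - (YJ + YU + YM) * (a + u + t)) * (XJ + XU + XM)))) * (XM - XYM) + (-(((a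 + δ + u + t) * (a + δ + u + t) * (XJ + XU + XM) + (a + δ + u + t) * ((a + δ + u + t) * (XU + XM) - (XJ + XU + XM) * (a + u + t))) - ((a + δ + u + t) * (XJ + XU + XM) * (YJ + YU + YM) + ((a + δ + u + t) * (XU + XM) - (XJ + XU + XM) * (a + u + t)) * (YJ + YU + YM) + ((a + δ + u + t) * (YU + YM) - (YJ + YU + YM) * (a + u + t)) * (XJ + XU + XM)))) * (YM - XYM)) + ((a + δ + u + t) * (XJ + XU + XM) * (YJ + YU + YM) + ((a + δ + u + t) * (XU + XM) - (XJ + XU + XM) * (a + u + t)) * (YJ + YU + YM) + ((a + δ + u + t) * (YU + YM) - (YJ + YU + YM) * (a + u + t)) * (XJ + XU + XM)) * ((XM - XYM) * (YM - XYM))) = (XYM * ((a * (a + ((a + δ) - a) + u + t) * (XJ + XU + XM) * (YJ + YU + YM) - (XJ * (a + ((a + δ) - a) + u + t) - ((a + δ) - a) * (XJ + XU + XM)) * (YM * (a + ((a + δ) - a) + u + t) - t * (YJ + YU + YM)) - (YJ * (a + ((a + δ) - a) + u + t) - ((a + δ) - a) * (YJ + YU + YM)) * (XM * (a + ((a + δ)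 - a) + u + t) - t * (XJ + XU + XM))) + ((a + ((a + δ) - a) + u + t) * ((a + ((a + δ) - a) + u + t) - (XJ + XU + XM)) * ((a + ((a + δ) - a) + u + t) - (YJ + YU + YM)) + (XJ * (a + ((a + δ) - a) + u + t) - ((a + δ) - a) * (XJ + XU + XM)) * ((a + ((a + δ) - a) + u + t) - (YJ + YU + YM)) + (YJ * (a + ((a + δ) - a) + u + t) - ((a + δ) - a) * (YJ + YU + YM)) * ((a + ((a + δ) - a) + u + t) - (XJ + XU + XM))) * XYM + (-(((a + ((a + δ) - a) + u + t) * (a + ((a + δ) - a) + u + t) * (YJ + YU + YM) + (a + ((a + δ) - a) + u + t) * ((a + ((a + δ) - a) + u + t) * (YU + YM) - (YJ + YU + YM) * (a + u + t))) - ((a + ((a + δ) - a) + u + t) * (XJ + XU + XM) * (YJ + YU + YM) + ((a + ((a + δ) - a) + u + t) * (XU + XM) - (XJ + XU + XM) * (a + u + t)) * (YJ + YU + YM) + ((a + ((a + δ) - a) + u + t) * (YU + YM) - (YJ + YU + YM) * (a + u + t)) * (XJ + XU + XM)))) * (XM - XYM) + (-(((a + ((a + δ) - a) + u + t) * (a +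 ((a + δ) - a) + u + t) * (XJ + XU + XM) + (a + ((a + δ) - a) + u + t) * ((a + ((a + δ) - a) + u + t) * (XU + XM) - (XJ + XU + XM) * (a + u + t))) - ((a + ((a + δ) - a) + u + t) * (XJ + XU + XM) * (YJ + YU + YM) + ((a + ((a + δ) - a) + u + t) * (XU + XM) - (XJ + XU + XM) * (a + u + t)) * (YJ + YU + YM) + ((a + ((a + δ) - a) + u + t) * (YU + YM) - (YJ + YU + YM) * (a + u + t)) * (XJ + XU + XM)))) * (YM - XYM)) + ((a + ((a + δ) - a) + u + t) * (XJ + XU + XM) * (YJ + YU + YM) + ((a + ((a + δ) - a) + u + t) * (XU + XM) - (XJ + XU + XM) * (a + u + t)) * (YJ + YU + YM) + ((a + ((a + δ) - a) + u + t) * (YU + YM) - (YJ + YU + YM) * (a + u + t)) * (XJ + XU + XM)) * ((XM - XYM) * (YM - XYM))) := by ring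
  rw [e, hs]
  exact add_nonneg h0 hslope

set_option maxHeartbeats 4000000 in
/-- **(M⁻) for every ideal mass when the `JM` facts hold without the ideal** (`δ·XM ≥ t·XJ`, `δ·YM ≥ t·YJ`): every
term of `cg_mminus_gen_id` is nonnegative. -/
theorem cg_mminus_of_JM0 (a δ u t XJ XU XM YJ YU YM XYM : R)
    (ha : 0 ≤ a) (hδ : 0 ≤ δ) (hu : 0 ≤ u) (ht : 0 ≤ t) (hXJ : 0 ≤ XJ) (hXU : 0 ≤ XU) (hXM : 0 ≤ XM)
    (hYJ : 0 ≤ YJ) (hYU : 0 ≤ YU) (hYM : 0 ≤ YM) (hXYM : 0 ≤ XYM)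
    (hsx : 0 ≤ (a + δ + u + t) * XM - t * (XJ + XU + XM)) (hsy : 0 ≤ (a + δ + u + t) * YM - t * (YJ + YU + YM))
    (hMM : 0 ≤ XYM * t - XM * YM)
    (hJMx : 0 ≤ δ * XM - t * XJ) (hJMy : 0 ≤ δ * YM - t * YJ)
    (hBBx : 0 ≤ (a + u) * XM - t * XU) (hBBy : 0 ≤ (a + u) * YM - t * YU)
    (hXMt : XM ≤ t) (hYMt : YM ≤ t) (hXYMx : XYM ≤ XM) :
    0 ≤ XYM * ((a * (a + δ + u + t) * (XJ + XU + XM) * (YJ + YU + YM) - (XJ * (a + δ + u + t) - δ * (XJ + XU + XM)) * (YM * (a + δ + u + t) - t * (YJ + YU + YM)) - (YJ * (a + δ + u + t) - δ * (YJ + YU + YM)) * (XM * (a + δ + u + t) - t * (XJ + XU + XM))) + ((a + δ + u + t) * ((a + δ + u + t) - (XJ + XU + XM)) * ((a + δ + u + t) - (YJ + YU + YM)) + (XJ * (a + δ + u + t) - δ * (XJ + XU + XM)) * ((a + δ + u + t) - (YJ + YU + YM)) + (YJ * (a + δ + u + t) - δ * (YJ + YU + YM)) * ((a + δ + u + t)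 - (XJ + XU + XM))) * XYM + (-(((a + δ + u + t) * (a + δ + u + t) * (YJ + YU + YM) + (a + δ + u + t) * ((a + δ + u + t) * (YU + YM) - (YJ + YU + YM) * (a + u + t))) - ((a + δ + u + t) * (XJ + XU + XM) * (YJ + YU + YM) + ((a + δ + u + t) * (XU + XM) - (XJ + XU + XM) * (a + u + t)) * (YJ + YU + YM) + ((a + δ + u + t) * (YU + YM) - (YJ + YU + YM) * (a + u + t)) * (XJ + XU + XM)))) * (XM - XYM) + (-(((a + δ + u + t) * (a + δ + u + t) * (XJ + XU + XM) + (a + δ + u + t) * ((a + δ + u + t) * (XU + XM) - (XJ + XU + XM) * (a + u + t))) - ((a + δ + u + t) * (XJ + XU + XM) * (YJ + YU + YM) + ((a + δ + u + t) * (XU + XM) - (XJ + XU + XM) * (a + u + t)) * (YJ + YU + YM) + ((a + δ + u + t) * (YU + YM) - (YJ + YU + YM) * (a + u + t)) * (XJ + XU + XM)))) * (YM - XYM)) + ((a + δ + u + t) * (XJ + XU + XM) * (YJ + YU + YM) + ((a + δ + u + t) * (XU + XM) - (XJ + XU + XM) * (a + u + t)) * (YJ + YU + YM) + ((a + δ +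 u + t) * (YU + YM) - (YJ + YU + YM) * (a + u + t)) * (XJ + XU + XM)) * ((XM - XYM) * (YM - XYM)) := by
  have hL : 0 ≤ a + δ + u + t := by linarith
  have hPx : 0 ≤ XJ + XU + XM := by linarith
  have hPy : 0 ≤ YJ + YU + YM := by linarith
  rcases ht.lt_or_eq with htpos | ht0
  · have H1 := mul_nonneg (mul_nonneg (mul_nonneg (mul_nonneg hL hsx) hsy) hXM) hYM
    have H2 := mul_nonneg (mul_nonneg (mul_nonneg (mul_nonneg hL hL) hL) hMM) hMM
    have H3 := mul_nonneg (mul_nonneg (mul_nonneg hL hL) hMM) (add_nonneg (mul_nonneg hXM hBBy) (mul_nonneg hYM hBBx))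
    have H4 := mul_nonneg (mul_nonneg hMM hL) (add_nonneg (mul_nonneg hJMx hsy) (mul_nonneg hJMy hsx))
    have H5 := mul_nonneg (mul_nonneg (mul_nonneg hMM ht) hδ) (add_nonneg (mul_nonneg hPy hsx) (mul_nonneg hPx hsy))
    have H6 := mul_nonneg (mul_nonneg (mul_nonneg (mul_nonneg (mul_nonneg (mul_nonneg ht ht) hL) hXYM) ha) hPx) hPy
    have key : 0 ≤ t * t * (XYM * ((a * (a + δ + u + t) * (XJ + XU + XM) * (YJ + YU + YM) - (XJ * (a + δ + u + t) - δ * (XJ + XU + XM)) * (YM * (a + δ + u + t) - t * (YJ + YU + YM)) - (YJ * (a + δ + u + t) - δ * (YJ + YU + YM)) * (XM * (a + δ + u + t) - t * (XJ + XU + XM))) + ((a + δ + u + t) * ((a + δ + u + t) - (XJ + XU + XM)) * ((a + δ + u + t) - (YJ + YU + YM)) + (XJ * (a + δ + u + t) - δ * (XJ + XU + XM)) * ((a + δ + u + t) - (YJ + YU + YM)) + (YJ * (a + δ + u + t) - δ * (YJ + YU + YM)) * ((a + δ + u + t) - (XJ + XU + XM))) * XYM + (-(((a + δ + u + t) * (a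 + δ + u + t) * (YJ + YU + YM) + (a + δ + u + t) * ((a + δ + u + t) * (YU + YM) - (YJ + YU + YM) * (a + u + t))) - ((a + δ + u + t) * (XJ + XU + XM) * (YJ + YU + YM) + ((a + δ + u + t) * (XU + XM) - (XJ + XU + XM) * (a + u + t)) * (YJ + YU + YM) + ((a + δ + u + t) * (YU + YM) - (YJ + YU + YM) * (a + u + t)) * (XJ + XU + XM)))) * (XM - XYM) + (-(((a + δ + u + t) * (a + δ + u + t) * (XJ + XU + XM) + (a + δ + u + t) * ((a + δ + u + t) * (XU + XM) - (XJ + XU + XM) * (a + u + t))) - ((a + δ + u + t) * (XJ + XU + XM) * (YJ + YU + YM) + ((a + δ + u + t) * (XU + XM) - (XJ + XU + XM) * (a + u + t)) * (YJ + YU + YM) + ((a + δ + u + t) * (YU + YM) - (YJ + YU + YM) * (a + u + t)) * (XJ + XU + XM)))) * (YM - XYM)) + ((a + δ + u + t) * (XJ + XU + XM) * (YJ + YU + YM) + ((a + δ + u + t) * (XU + XM) - (XJ + XU + XM) * (a + u + t)) * (YJ + YU + YM) + ((a + δ + u + t) * (YU + YM) - (YJ + YU + YM) * (a + u + t)) *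 (XJ + XU + XM)) * ((XM - XYM) * (YM - XYM))) := by
      rw [cg_mminus_gen_id]
      linear_combination H1 + H2 + H3 + H4 + H5 + H6
    exact (mul_nonneg_iff_of_pos_left (mul_pos htpos htpos)).mp key
  · have hXM0 : XM = 0 := le_antisymm (by linarith) hXM
    have hYM0 : YM = 0 := le_antisymm (by linarith) hYM
    have hXYM0 : XYM = 0 := le_antisymm (by linarith) hXYM
    rw [← ht0, hXM0, hYM0, hXYM0]
    simp

end MMinusGen

end Summit.Ventures.PercRepro2.Coin
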